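import Summits.HodgeConjecture.CorCM.GaloisNonNormalPrimeOrderQuotient
import Summits.HodgeConjecture.CorCM.GaloisMaximalNormalPSubgroup
import HarnessLib

/-!
# GOOD Galois CM fields have NORMAL Sylow `p`-subgroups for odd `p` — unconditionally for `p ≥ 31`

COR-CM (cell `pub-hodgecm2`), binder seat b04 (gen 38), count-neutral own lane «Galois-CM-type classification».  KERNEL ONLY:
theorems; no definition, no named fact, no `sorry`.  `HC_CM` is neither used nor claimed.

A Galois CM field `K` is GOOD when every primitive CM type of `K` is nondegenerate (the Hodge ring of every power of every simple abelian
variety with CM by `K` is generated by divisor classes).  Gen 33 (`CorCM/GaloisNonNormalPrimeOrder`): in a GOOD field of degree `2pn` with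
`16 ≤ n`, `8p ≤ 2^(n/4)`, every subgroup of order `p` of `Gal(K/ℚ)` is normal; gen 38 (`CorCM/GaloisNonNormalPrimeOrderQuotient`)
transports this to every CM quotient `Gal(K/ℚ)/N`.  THE STEP HERE: let `N = O_p(Gal)` be the normal `p`-subgroup of maximal order
(`CorCM/GaloisMaximalNormalPSubgroup`, `p` odd, so `c ∉ N` and `K^N` is a CM field).  If `p ∣ [Gal:N]`, Cauchy's theorem in `Gal/N`
gives a subgroup of order `p`, which cannot be normal (its preimage would be a larger normal `p`-subgroup) — contradicting gen 33 in the
GOOD CM quotient `K^N`, of degree `[Gal:N] = 2p · (p^{a-j-1} m) ≥ 2pm`.  Hence `p ∤ [Gal:N]`: **`N` is a NORMAL SYLOW `p`-SUBGROUP**.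

* `sylow_normal_of_forall_isNondegenerate` — `[K:ℚ] = 2·pᵃ·m`, `p ∤ m`, `p` odd, `16 ≤ m`, `8p ≤ 2^(m/4)`, `K` GOOD ⟹ every Sylow
  `p`-subgroup of `Gal(K/ℚ)` is normal (so there is exactly one, of order `pᵃ`).
* `sylow_three_normal_of_forall_isNondegenerate` — `p = 3`: `[K:ℚ] = 2·3ᵃ·m`, `3 ∤ m`, `14 ≤ m` (gen 33's threshold `84 = 6·14`).
* **`sylow_normal_of_forall_isNondegenerate_of_ge`** — `p ≥ 31` prime, `K` GOOD of ANY degree ⟹ the Sylow `p`-subgroups of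
  `Gal(K/ℚ)` are normal.  No size hypothesis: if the Sylow `p`-subgroup of `Gal/N` is not normal, Sylow's third theorem gives
  `[Gal:N] ≥ 2p(p+1)` (`NormalSylow.card_ge_of_sylow_not_normal`), which already implies gen 33's size condition when `p ≥ 31`
  (`eight_mul_le_two_pow_of_prime_ge`); if it is normal it lifts to `Gal`.
So the odd part of the Galois group of a GOOD Galois CM field is controlled prime by prime: `CorCM/GaloisOddNormalHallSubgroup` (gen 38)
shows that a normal Sylow `p`-subgroup (`p` odd) of a GOOD field has order `≤ p` and that two odd primes cannot both occur.

## References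

* [Shimura1998] G. Shimura, *Abelian Varieties with Complex Multiplication and Modular Functions*, §6.2 Thm. 3, §8.2 Prop. 26, §32.10.
* [Kubota1965] T. Kubota, *On the field extension by complex multiplication*, Trans. AMS 118 (1965), §2 and §4 Lemma 2.
* [Rotman1995] J. J. Rotman, *An Introduction to the Theory of Groups*, 4th ed., GTM 148, Thm. 4.2, Thm. 4.12, Ex. 4.11.
-/

noncomputable section

open CategoryTheory CategoryTheory.Limits NumberField
open scoped BigOperators

namespace Summit.HodgeConjecture.CorCM.GaloisModels

open Literature.NumberTheory.ComplexMultiplication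
open Literature.AlgebraicGeometry.Motives (AbelianVariety CMType)
open Literature.AlgebraicGeometry.HodgeTheory
open Literature.AlgebraicGeometry.ComplexMultiplication (IsCMTypeRealisation)
open Literature.AlgebraicGeometry.Pohlmann1968
open Summit.HodgeConjecture.CorCM.GaloisRank
open Summit.HodgeConjecture.CorCM.GaloisModels.NormalSylow

/-! ## §1 Arithmetic of the size condition -/

/-- `8p ≤ 2^(n/4)` for a prime `p ≥ 31` and `n ≥ p + 1` (for `p = 31`: `248 ≤ 2⁸`; for `p ≥ 37`: `8p ≤ 32⌊n/4⌋ + 16 ≤ 2^⌊n/4⌋`).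
[folklore] -/
theorem eight_mul_le_two_pow_of_prime_ge {p n : ℕ} (hp : p.Prime) (h31 : 31 ≤ p) (hn : p + 1 ≤ n) : 8 * p ≤ 2 ^ (n / 4) := by
  have key : ∀ u : ℕ, 9 ≤ u → 32 * u + 16 ≤ 2 ^ u := by
    intro u hu
    induction u, hu using Nat.le_induction with
    | base => norm_num
    | succ u _ ih => rw [pow_succ]; omega
  by_cases h35 : 35 ≤ p
  · have h1 := key (n / 4) (by omega)
    omega
  · have hp31 : p = 31 := by
      interval_cases p
      · rfl
      all_goals exact absurd hp (by norm_num)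
    subst hp31
    calc 8 * 31 ≤ 2 ^ 8 := by norm_num
      _ ≤ 2 ^ (n / 4) := Nat.pow_le_pow_right two_pos (by omega)

/-- Index bookkeeping: `pʲ · i = 2 · pᵃ · m` with `p ∤ 2m` and `p ∣ i` ⟹ `i = 2p · n` for some `n ≥ m`. [folklore] -/
theorem index_eq_of_pow_mul_eq {p j i a m : ℕ} (hp : p.Prime) (hp2 : p ≠ 2) (hpm : ¬ p ∣ m) (hk : p ^ j * i = 2 * p ^ a * m)
    (hpi : p ∣ i) : ∃ n : ℕ, i = 2 * p * n ∧ m ≤ n := by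
  have hp0 : 0 < p := hp.pos
  -- `j < a`
  have hja : j < a := by
    by_contra hle
    push Not at hle
    obtain ⟨d, rfl⟩ := Nat.exists_eq_add_of_le hle
    obtain ⟨i', rfl⟩ := hpi
    have h1 : p ^ a * (p ^ d * p * i') = p ^ a * (2 * m) := by
      calc p ^ a * (p ^ d * p * i') = p ^ (a + d) * (p * i') := by ring
        _ = 2 * p ^ a * m := hk
        _ = p ^ a * (2 * m) := by ring
    have h2 : p ^ d * p * i' = 2 * m := Nat.eq_of_mul_eq_mul_left (pow_pos hp0 a) h1
    have h3 : p ∣ 2 * m := ⟨p ^ d * i', by rw [← h2]; ring⟩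
    rcases (Nat.Prime.dvd_mul hp).1 h3 with h | h
    · exact hp2 ((Nat.prime_dvd_prime_iff_eq hp Nat.prime_two).1 h)
    · exact hpm h
  obtain ⟨d, rfl⟩ := Nat.exists_eq_add_of_lt hja
  refine ⟨p ^ d * m, ?_, Nat.le_mul_of_pos_left m (pow_pos hp0 d)⟩
  have h1 : p ^ j * i = p ^ j * (2 * p * (p ^ d * m)) := by rw [hk]; ring
  exact Nat.eq_of_mul_eq_mul_left (pow_pos hp0 j) h1

/-! ## §2 Normal Sylow subgroups under gen 33's size condition -/

variable {K : Type} [Field K] [NumberField K] [IsCMField K] [IsGalois ℚ K]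

/-- Complex conjugation is not in a `p`-subgroup for `p` odd. [folklore] -/
theorem complexConj_not_mem_of_isPGroup {p : ℕ} [hp : Fact p.Prime] (hp2 : p ≠ 2) (N : Subgroup (K ≃ₐ[ℚ] K))
    (hNP : IsPGroup p N) : (IsCMField.complexConj K).restrictScalars ℚ ∉ N := by
  intro hc
  have hcc := model_complexConj_mul_self (K := K) (MulEquiv.refl _) rfl
  have hc1 := model_complexConj_ne_one (K := K) (MulEquiv.refl _) rfl
  rw [MulEquiv.refl_apply] at hcc hc1
  obtain ⟨k, hk⟩ := hNP ⟨_, hc⟩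
  have hk' : ((IsCMField.complexConj K).restrictScalars ℚ) ^ p ^ k = 1 := by
    have := congrArg Subtype.val hk
    simpa using this
  have h2 : orderOf ((IsCMField.complexConj K).restrictScalars ℚ) = 2 :=
    orderOf_eq_prime (by rw [pow_two]; exact hcc) hc1
  have hdvd : 2 ∣ p ^ k := by rw [← h2]; exact orderOf_dvd_of_pow_eq_one hk'
  exact hp2 ((Nat.prime_dvd_prime_iff_eq Nat.prime_two hp.out).1 (Nat.Prime.dvd_of_dvd_pow Nat.prime_two hdvd)).symm

/-- **GOOD ⟹ NORMAL SYLOW `p`-SUBGROUPS (odd `p`, gen 33's size condition).**  `K` a Galois CM field of degree `2·pᵃ·m` with `p` an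
odd prime, `p ∤ m`, `16 ≤ m`, `8p ≤ 2^(m/4)`; if every primitive CM type of `K` is nondegenerate, then every Sylow `p`-subgroup of
`Gal(K/ℚ)` is normal. [cite: Shimura1998, §8.2 Prop. 26 and §32.10] [cite: Kubota1965, §2 and §4 Lemma 2] [cite: Rotman1995, Thm. 4.12] -/
theorem sylow_normal_of_forall_isNondegenerate (p a m : ℕ) [hp : Fact p.Prime] (hp2 : p ≠ 2)
    (hdeg : Module.finrank ℚ K = 2 * p ^ a * m) (hpm : ¬ p ∣ m) (hm : 16 ≤ m) (h8 : 8 * p ≤ 2 ^ (m / 4))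
    (hgood : ∀ (Φ : CMType K) (φ : K →+* ℂ), IsPrimitive (ℂ ≃+* ℂ) Φ.1 φ → IsNondegenerate Φ)
    (P : Sylow p (K ≃ₐ[ℚ] K)) : (P : Subgroup (K ≃ₐ[ℚ] K)).Normal := by
  classical
  rcases sylow_normal_or_exists_nonnormal_mod (K ≃ₐ[ℚ] K) p with hall | ⟨N, hN, hNP, -, hdvd, x, g, hxN, hxp, hg⟩
  · exact hall P
  exfalso
  haveI := hN
  have hcN := complexConj_not_mem_of_isPGroup hp2 N hNP
  -- `[Gal:N] = 2p·n` with `n ≥ m`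
  obtain ⟨j, hj⟩ := IsPGroup.iff_card.1 hNP
  have hk : p ^ j * N.index = 2 * p ^ a * m := by
    rw [← hj, mul_comm, Subgroup.index_mul_card, IsGalois.card_aut_eq_finrank, hdeg]
  obtain ⟨n, hidx, hmn⟩ := index_eq_of_pow_mul_eq hp.out hp2 hpm hk hdvd
  have hn : 16 ≤ n := le_trans hm hmn
  have h8' : 8 * p ≤ 2 ^ (n / 4) := le_trans h8 (Nat.pow_le_pow_right two_pos (Nat.div_le_div_right hmn))
  obtain ⟨k, -, hk⟩ := exists_conj_pow_mod_of_forall_isNondegenerate N hcN p n hidx hn h8' hgood x hxN hxp g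
  exact hg k hk

/-- **… `p = 3`**: `[K:ℚ] = 2·3ᵃ·m`, `3 ∤ m`, `14 ≤ m`, `K` GOOD ⟹ every Sylow `3`-subgroup of `Gal(K/ℚ)` is normal.
[cite: Shimura1998, §8.2 Prop. 26 and §32.10] [cite: Kubota1965, §2 and §4 Lemma 2] [cite: Rotman1995, Thm. 4.12] -/
theorem sylow_three_normal_of_forall_isNondegenerate (a m : ℕ) (hdeg : Module.finrank ℚ K = 2 * 3 ^ a * m) (h3m : ¬ 3 ∣ m)
    (hm : 14 ≤ m) (hgood : ∀ (Φ : CMType K) (φ : K →+* ℂ), IsPrimitive (ℂ ≃+* ℂ) Φ.1 φ → IsNondegenerate Φ)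
    [Fact (Nat.Prime 3)] (P : Sylow 3 (K ≃ₐ[ℚ] K)) : (P : Subgroup (K ≃ₐ[ℚ] K)).Normal := by
  classical
  rcases sylow_normal_or_exists_nonnormal_mod (K ≃ₐ[ℚ] K) 3 with hall | ⟨N, hN, hNP, -, hdvd, x, g, hxN, hxp, hg⟩
  · exact hall P
  exfalso
  haveI := hN
  have hcN := complexConj_not_mem_of_isPGroup (p := 3) (by norm_num) N hNP
  obtain ⟨j, hj⟩ := IsPGroup.iff_card.1 hNP
  have hk : 3 ^ j * N.index = 2 * 3 ^ a * m := by
    rw [← hj, mul_comm, Subgroup.index_mul_card, IsGalois.card_aut_eq_finrank, hdeg]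
  obtain ⟨n, hidx, hmn⟩ := index_eq_of_pow_mul_eq Nat.prime_three (by norm_num) h3m hk hdvd
  have h84 : 84 ≤ N.index := by rw [hidx]; omega
  obtain ⟨k, -, hk⟩ := exists_conj_pow_three_mod_of_forall_isNondegenerate N hcN h84 hgood x hxN hxp g
  exact hg k hk

/-! ## §3 `p ≥ 31`: no size hypothesis -/

/-- **GOOD ⟹ NORMAL SYLOW `p`-SUBGROUPS FOR EVERY PRIME `p ≥ 31`, IN EVERY DEGREE.**  If every primitive CM type of the Galois CM
field `K` is nondegenerate, then for every prime `p ≥ 31` the Sylow `p`-subgroups of `Gal(K/ℚ)` are normal.  (With `N = O_p(Gal)`: if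
`p ∣ [Gal:N]`, then either the Sylow `p`-subgroup of `Gal/N` is normal and lifts, or Sylow III gives `[Gal:N] ≥ 2p(p+1)`, whence gen
33's size condition holds for the CM quotient `K^N`, whose subgroup of order `p` from Cauchy's theorem is not normal.)
[cite: Shimura1998, §8.2 Prop. 26 and §32.10] [cite: Kubota1965, §2 and §4 Lemma 2] [cite: Rotman1995, Thm. 4.2 and Thm. 4.12] -/
theorem sylow_normal_of_forall_isNondegenerate_of_ge (p : ℕ) [hp : Fact p.Prime] (h31 : 31 ≤ p)
    (hgood : ∀ (Φ : CMType K) (φ : K →+* ℂ), IsPrimitive (ℂ ≃+* ℂ) Φ.1 φ → IsNondegenerate Φ)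
    (P : Sylow p (K ≃ₐ[ℚ] K)) : (P : Subgroup (K ≃ₐ[ℚ] K)).Normal := by
  classical
  have hp2 : p ≠ 2 := by omega
  rcases sylow_normal_or_exists_nonnormal_mod (K ≃ₐ[ℚ] K) p with hall | ⟨N, hN, hNP, hmax, hdvd, x, g, hxN, hxp, hg⟩
  · exact hall P
  exfalso
  haveI := hN
  have hcN := complexConj_not_mem_of_isPGroup hp2 N hNP
  -- the Sylow `p`-subgroups of `Gal/N` are not all normal
  have hQ : ∃ Q : Sylow p ((K ≃ₐ[ℚ] K) ⧸ N), ¬ (Q : Subgroup ((K ≃ₐ[ℚ] K) ⧸ N)).Normal := by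
    by_contra h
    push Not at h
    exact not_dvd_index_of_maximal_of_sylow_quotient_normal N hNP hmax h hdvd
  obtain ⟨Q, hQ⟩ := hQ
  -- complex conjugation modulo `N`: a central involution of `Gal/N`
  set c := (IsCMField.complexConj K).restrictScalars ℚ with hc
  have hcomm := model_complexConj_comm (K := K) (MulEquiv.refl _) rfl
  have hcc := model_complexConj_mul_self (K := K) (MulEquiv.refl _) rfl
  rw [MulEquiv.refl_apply] at hcc
  have hcz' : ∀ q : (K ≃ₐ[ℚ] K) ⧸ N, (QuotientGroup.mk c : (K ≃ₐ[ℚ] K) ⧸ N) * q = q * QuotientGroup.mk c := by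
    intro q
    obtain ⟨y, rfl⟩ := QuotientGroup.mk_surjective q
    rw [← QuotientGroup.mk_mul, ← QuotientGroup.mk_mul]
    congr 1
    simpa using hcomm y
  have hcc' : (QuotientGroup.mk c : (K ≃ₐ[ℚ] K) ⧸ N) * QuotientGroup.mk c = 1 := by
    rw [← QuotientGroup.mk_mul, hcc, QuotientGroup.mk_one]
  have hc1' : (QuotientGroup.mk c : (K ≃ₐ[ℚ] K) ⧸ N) ≠ 1 := fun h => hcN ((QuotientGroup.eq_one_iff c).1 h)
  -- `[Gal:N] ≥ 2p(p+1)` and `2p ∣ [Gal:N]`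
  have hbig : 2 * p * (p + 1) ≤ N.index := card_ge_of_sylow_not_normal hp2 hcz' hcc' hc1' Q hQ
  have h2 : 2 ∣ N.index := by
    have hord : orderOf (QuotientGroup.mk c : (K ≃ₐ[ℚ] K) ⧸ N) = 2 := orderOf_eq_prime (by rw [pow_two, hcc']) hc1'
    rw [← hord]
    exact orderOf_dvd_natCard _
  obtain ⟨n, hn⟩ : 2 * p ∣ N.index :=
    Nat.Coprime.mul_dvd_of_dvd_of_dvd ((Nat.coprime_primes Nat.prime_two hp.out).2 (Ne.symm hp2)) h2 hdvd
  have hpn : p + 1 ≤ n := by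
    rw [hn] at hbig
    exact Nat.le_of_mul_le_mul_left hbig (by positivity)
  have hn16 : 16 ≤ n := by omega
  have h8 : 8 * p ≤ 2 ^ (n / 4) := eight_mul_le_two_pow_of_prime_ge hp.out h31 hpn
  obtain ⟨k, -, hk⟩ := exists_conj_pow_mod_of_forall_isNondegenerate N hcN p n hn hn16 h8 hgood x hxN hxp g
  exact hg k hk

/-- **… so for `p ≥ 31` the Galois group of a GOOD field has a unique Sylow `p`-subgroup**, which is normal, of order the `p`-part of
`[K:ℚ]`. [cite: Shimura1998, §8.2 Prop. 26 and §32.10] [cite: Rotman1995, Thm. 4.12] -/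
theorem subsingleton_sylow_of_forall_isNondegenerate_of_ge (p : ℕ) [Fact p.Prime] (h31 : 31 ≤ p)
    (hgood : ∀ (Φ : CMType K) (φ : K →+* ℂ), IsPrimitive (ℂ ≃+* ℂ) Φ.1 φ → IsNondegenerate Φ) :
    Subsingleton (Sylow p (K ≃ₐ[ℚ] K)) := by
  classical
  obtain ⟨P⟩ := (inferInstance : Nonempty (Sylow p (K ≃ₐ[ℚ] K)))
  exact (Sylow.unique_of_normal P (sylow_normal_of_forall_isNondegenerate_of_ge p h31 hgood P)).instSubsingleton

end Summit.HodgeConjecture.CorCM.GaloisModels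

end
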